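import Summits.Ventures.PercRepro.S1CoreCapSpecSpreadFiveLines

/-!
# PercRepro — TOWARDS THE INSTANCE `ν = 5` OF THE SPREAD SPEC: SIMPLE 3-POINT LINES, PART 3 — THE PENCIL, AND `≤ 7` (p1, gen 32)

`proofs/P1-S2-CORANK6.md` §4g. The last two cases of the all-simple configurations of cost `≤ 5` under the spread clause, and the assembly:
* **the pencil** (`pencil_count`): every line through `a` is disjoint from every line avoiding `a`. A list of `n ≥ 1` lines through `a` has
  rank bound `n + 1` on `2n + 1` points (`pencil_list`), so at most five lines pass through `a` (cost `n ≤ 5`); two of them leave room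
  for `≤ 4` disjoint lines (cost `2`), three of them for `≤ 2` (cost `3`): `≤ 6` or `≤ 7` lines;
* **pairwise disjoint lines** (`card_le_seven_of_pairwise_disjoint`): the lines other than one satisfy the cost clause at nullity `4`
  (`cost_clause_restrict`), so they are at most six (`card_le_six_of_three_points_spread`, the instance `ν = 4`);
* **the assembly** (`card_le_seven_of_three_points_spread_five`): a triangle ⟹ `≤ 6` (`card_le_six_of_triangle`); otherwise two lines meet
  at `a`, and either some line avoiding `a` meets a line through `a` (`tf_count`: `≤ 7`) or the pencil case (`≤ 7`); or no two lines meet.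
The search's maximum is `6`; `7` is what the cap `8` of the assembly needs. Axioms: standard.
-/

namespace PercRepro

namespace S1

namespace FourCap

variable {β : Type} [DecidableEq β]

section LinesP

variable {w : β → ℕ} {ls : Finset (Finset β)}
  (hw1 : ∀ L ∈ ls, ∀ v ∈ L, w v = 1)
  (hcard : ∀ L ∈ ls, L.card = 3)
  (h3 : ∀ L ∈ ls, ∀ L' ∈ ls, L ≠ L' → (L ∩ L').card ≤ 1)
  (h4 : ∀ l : List (Finset β), l.Nodup → (∀ L ∈ l, L ∈ ls) → wsum w (unionL l) ≤ 5 + lineRank l)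
  (h7 : ∀ l : List (Finset β), l.Nodup → (∀ L ∈ l, L ∈ ls) → lineRank l ≤ 4 → wsum w (unionL l) ≤ lineRank l + 3)

include h3 in
/-- A line through `a` meets the union of a nonempty list of other lines through `a` exactly in `a`. -/
theorem inter_unionL_pencil {a : β} {L : Finset β} (hL : L ∈ ls) (haL : a ∈ L) {l : List (Finset β)}
    (hl : ∀ L' ∈ l, L' ∈ ls ∧ a ∈ L') (hLl : L ∉ l) {L₀ : Finset β} (hL₀ : L₀ ∈ l) : L ∩ unionL l = {a} := by
  ext x
  rw [Finset.mem_inter, mem_unionL_iff, Finset.mem_singleton]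
  constructor
  · rintro ⟨hxL, L', hL', hxL'⟩
    have hne : L ≠ L' := fun h => hLl (h ▸ hL')
    exact Finset.card_le_one.1 (h3 L hL L' (hl L' hL').1 hne) x (Finset.mem_inter.2 ⟨hxL, hxL'⟩) a
      (Finset.mem_inter.2 ⟨haL, (hl L' hL').2⟩)
  · rintro rfl
    exact ⟨haL, L₀, hL₀, (hl L₀ hL₀).2⟩

include hcard h3 in
/-- **A pencil list**: `n ≥ 1` distinct lines through `a` have rank bound `n + 1` and `2n + 1` points. -/
theorem pencil_list {a : β} : ∀ l : List (Finset β), l.Nodup → (∀ L ∈ l, L ∈ ls ∧ a ∈ L) → l ≠ [] →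
    lineRank l = l.length + 1 ∧ (unionL l).card = 2 * l.length + 1
  | [], _, _, hne => absurd rfl hne
  | L :: l, hnd, hl, _ => by
    have hL := hl L List.mem_cons_self
    have hl' : ∀ L' ∈ l, L' ∈ ls ∧ a ∈ L' := fun L' hL' => hl L' (List.mem_cons_of_mem _ hL')
    have hnd' := List.nodup_cons.1 hnd
    have kL := hcard L hL.1
    rcases l with _ | ⟨L₀, l⟩
    · simp only [unionL, lineRank, Finset.union_empty, Finset.sdiff_empty, Finset.inter_empty, Finset.card_empty,
        Nat.zero_add, List.length_singleton]
      rw [show (2 - min 0 2 : ℕ) = 2 by decide, kL]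
      decide
    · obtain ⟨ih1, ih2⟩ := pencil_list (L₀ :: l) hnd'.2 hl' (by simp)
      have hi : L ∩ unionL (L₀ :: l) = {a} := inter_unionL_pencil h3 hL.1 hL.2 hl' hnd'.1 List.mem_cons_self
      have hic : (L ∩ unionL (L₀ :: l)).card = 1 := by rw [hi]; simp
      have hsd : (L \ unionL (L₀ :: l)).card + (L ∩ unionL (L₀ :: l)).card = L.card :=
        Finset.card_sdiff_add_card_inter _ _
      have hu : (L ∪ unionL (L₀ :: l)).card + (L ∩ unionL (L₀ :: l)).card = L.card + (unionL (L₀ :: l)).card :=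
        Finset.card_union_add_card_inter _ _
      have e1 : lineRank (L :: L₀ :: l) = lineRank (L₀ :: l) +
          min (L \ unionL (L₀ :: l)).card (2 - min (L ∩ unionL (L₀ :: l)).card 2) := rfl
      have e2 : unionL (L :: L₀ :: l) = L ∪ unionL (L₀ :: l) := rfl
      refine ⟨?_, ?_⟩
      · rw [e1, hic, show (2 - min 1 2 : ℕ) = 1 by decide, ih1]
        simp only [List.length_cons]
        omega
      · rw [e2]
        simp only [List.length_cons] at ih2 ⊢
        omega

include hw1 hcard h3 h4 in
/-- **At most five lines through a point** (a pencil list of `n` lines costs `n`). -/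
theorem card_pencil_le_five {a : β} : (ls.filter (fun L => a ∈ L)).card ≤ 5 := by
  set P := ls.filter (fun L => a ∈ L) with hP
  rcases Finset.eq_empty_or_nonempty P with h0 | hne
  · rw [h0]; simp
  have hl : ∀ L ∈ P.toList, L ∈ ls ∧ a ∈ L := fun L hL => Finset.mem_filter.1 (Finset.mem_toList.1 hL)
  have hnil : P.toList ≠ [] := by
    rw [Ne, Finset.toList_eq_nil]
    exact Finset.nonempty_iff_ne_empty.1 hne
  obtain ⟨h1, h2⟩ := pencil_list hcard h3 P.toList (Finset.nodup_toList P) hl hnil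
  have hc := h4 P.toList (Finset.nodup_toList P) (fun L hL => (hl L hL).1)
  rw [wsum_unionL_eq_card hw1 _ (fun L hL => (hl L hL).1), h1, h2, Finset.length_toList] at hc
  omega

include hw1 hcard h3 h4 in
/-- **The pencil case: at most seven lines** — with every line through `a` disjoint from every line avoiding `a`, at most five lines pass
through `a`; two of them leave at most four lines avoiding `a`, three of them at most two. -/
theorem pencil_count {a : β} {A X : Finset β} (hA : A ∈ ls) (hX : X ∈ ls) (hAX : A ≠ X) (haA : a ∈ A) (haX : a ∈ X)
    (hno : ∀ Y ∈ ls, a ∉ Y → ∀ B ∈ ls, a ∈ B → Disjoint Y B) : ls.card ≤ 7 := by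
  have hsplit := Finset.card_filter_add_card_filter_not (fun L => a ∈ L) (s := ls)
  have hP := card_pencil_le_five hw1 hcard h3 h4 (a := a)
  have hAP : A ∈ ls.filter (fun L => a ∈ L) := Finset.mem_filter.2 ⟨hA, haA⟩
  have hXP : X ∈ ls.filter (fun L => a ∈ L) := Finset.mem_filter.2 ⟨hX, haX⟩
  by_cases hbig : 2 < (ls.filter (fun L => a ∈ L)).card
  · -- three lines through `a`: the lines avoiding `a` are disjoint from a base of cost `3`
    obtain ⟨X', hX'P, hX'A, hX'X⟩ := exists_third hbig hAP hXP hAX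
    obtain ⟨hX', haX'⟩ := Finset.mem_filter.1 hX'P
    obtain ⟨hr, hu⟩ := pencil_list hcard h3 (a := a) [X', X, A] (by simp [hAX.symm, hX'A, hX'X])
      (by simp [hA, hX, hX', haA, haX, haX']) (by simp)
    simp only [List.length_cons, List.length_nil] at hr hu
    have hb : ([X', X, A] : List (Finset β)).Nodup := by simp [hAX.symm, hX'A, hX'X]
    have hbl : ∀ L ∈ ([X', X, A] : List (Finset β)), L ∈ ls := by simp [hA, hX, hX']
    have hwU : wsum w (unionL [X', X, A]) = 7 := by rw [wsum_unionL_eq_card hw1 _ hbl, hu]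
    have hD := card_filter_disjoint_le_two (h1_of_simple hw1) (h2_of_simple hw1 hcard) h3 h4 hb hbl (by rw [hr, hwU])
    have hsub : ls.filter (fun L => ¬ a ∈ L) ⊆ ls.filter (fun L => Disjoint L (unionL [X', X, A])) := by
      intro Y hY
      rw [Finset.mem_filter] at hY ⊢
      refine ⟨hY.1, ?_⟩
      simp only [unionL, Finset.union_empty]
      exact Finset.disjoint_union_right.2 ⟨hno Y hY.1 hY.2 X' hX' haX',
        Finset.disjoint_union_right.2 ⟨hno Y hY.1 hY.2 X hX haX, hno Y hY.1 hY.2 A hA haA⟩⟩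
    have := Finset.card_le_card hsub
    omega
  · -- exactly two lines through `a`: the lines avoiding `a` are disjoint from a base of cost `2`
    obtain ⟨hr, hu⟩ := pencil_list hcard h3 (a := a) [X, A] (by simp [hAX.symm]) (by simp [hA, hX, haA, haX]) (by simp)
    simp only [List.length_cons, List.length_nil] at hr hu
    have hb : ([X, A] : List (Finset β)).Nodup := by simp [hAX.symm]
    have hbl : ∀ L ∈ ([X, A] : List (Finset β)), L ∈ ls := by simp [hA, hX]
    have hwU : wsum w (unionL [X, A]) = 5 := by rw [wsum_unionL_eq_card hw1 _ hbl, hu]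
    have hD := card_filter_disjoint_le_four (h1_of_simple hw1) (h2_of_simple hw1 hcard) h3 h4 hb hbl (by rw [hr, hwU])
    have hsub : ls.filter (fun L => ¬ a ∈ L) ⊆ ls.filter (fun L => Disjoint L (unionL [X, A])) := by
      intro Y hY
      rw [Finset.mem_filter] at hY ⊢
      refine ⟨hY.1, ?_⟩
      simp only [unionL, Finset.union_empty]
      exact Finset.disjoint_union_right.2 ⟨hno Y hY.1 hY.2 X hX haX, hno Y hY.1 hY.2 A hA haA⟩
    have := Finset.card_le_card hsub
    omega

include hw1 hcard h3 h4 h7 in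
/-- **Pairwise disjoint lines: at most seven** — the lines other than `A` satisfy the cost clause at nullity `4` (`cost_clause_restrict`
on the base `[A]` of cost `1`), hence are at most six by the instance `ν = 4`. -/
theorem card_le_seven_of_pairwise_disjoint {A : Finset β} (hA : A ∈ ls)
    (hdisj : ∀ L ∈ ls, L ≠ A → Disjoint L A) : ls.card ≤ 7 := by
  set D := ls.filter (fun L => Disjoint L (unionL [A])) with hD
  have hDm : ∀ L ∈ D, L ∈ ls ∧ Disjoint L (unionL [A]) := fun L hL => Finset.mem_filter.1 hL
  have hb : ([A] : List (Finset β)).Nodup := List.nodup_singleton A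
  have hbl : ∀ L ∈ ([A] : List (Finset β)), L ∈ ls := by simp [hA]
  have hcost : 5 + lineRank [A] ≤ 4 + wsum w (unionL [A]) := by
    simp only [unionL, lineRank, Finset.union_empty, Finset.sdiff_empty, Finset.inter_empty, Finset.card_empty,
      Nat.zero_add]
    rw [show (2 - min 0 2 : ℕ) = 2 by decide, wsum_eq_card_simple hw1 hA, hcard A hA]
    decide
  have h4' : ∀ l : List (Finset β), l.Nodup → (∀ L ∈ l, L ∈ D) → wsum w (unionL l) ≤ 4 + lineRank l := by
    intro l hl hll
    refine cost_clause_restrict h4 hb hbl hcost l hl (fun L hL => (hDm L (hll L hL)).1)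
      (fun L hL => (hDm L (hll L hL)).2) ?_
    intro L hL hLb
    exact not_disjoint_unionL_of_mem (h2_of_simple hw1 hcard) hbl hLb (hDm L (hll L hL)).2
  have hsix : D.card ≤ 6 :=
    card_le_six_of_three_points_spread (fun L hL => hw1 L (hDm L hL).1) (fun L hL => hcard L (hDm L hL).1)
      (fun L hL L' hL' hne => h3 L (hDm L hL).1 L' (hDm L' hL').1 hne) h4'
      (fun l hl hll => h7 l hl (fun L hL => (hDm L (hll L hL)).1))
  have hcover : ls ⊆ ({A} : Finset (Finset β)) ∪ D := by
    intro L hL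
    rw [Finset.mem_union, Finset.mem_singleton]
    by_cases hLA : L = A
    · exact Or.inl hLA
    refine Or.inr (Finset.mem_filter.2 ⟨hL, ?_⟩)
    simp only [unionL, Finset.union_empty]
    exact hdisj L hL hLA
  have hc := Finset.card_le_card hcover
  have hu := Finset.card_union_le ({A} : Finset (Finset β)) D
  rw [Finset.card_singleton] at hu
  omega

include hw1 hcard h3 h4 h7 in
/-- **Every configuration of simple 3-point lines of cost `≤ 5` under the spread clause has at most seven lines** (the search: six). -/
theorem card_le_seven_of_three_points_spread_five : ls.card ≤ 7 := by
  by_cases htri : ∃ X ∈ ls, ∃ Y ∈ ls, ∃ Z ∈ ls, X ≠ Y ∧ Y ≠ Z ∧ X ≠ Z ∧ (X ∩ Y).Nonempty ∧ (Y ∩ Z).Nonempty ∧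
      (X ∩ Z).Nonempty ∧ X ∩ Y ∩ Z = ∅
  · -- a triangle
    obtain ⟨X, hX, Y, hY, Z, hZ, hXY, hYZ, hXZ, ⟨c, hc⟩, ⟨a, ha⟩, ⟨b, hb⟩, hempty⟩ := htri
    rw [Finset.mem_inter] at hc ha hb
    have hab : a ≠ b := by
      rintro rfl
      exact Finset.notMem_empty a (hempty ▸ Finset.mem_inter.2 ⟨Finset.mem_inter.2 ⟨hb.1, ha.1⟩, ha.2⟩)
    have hac : a ≠ c := by
      rintro rfl
      exact Finset.notMem_empty a (hempty ▸ Finset.mem_inter.2 ⟨Finset.mem_inter.2 ⟨hc.1, hc.2⟩, ha.2⟩)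
    have hbc : b ≠ c := by
      rintro rfl
      exact Finset.notMem_empty b (hempty ▸ Finset.mem_inter.2 ⟨Finset.mem_inter.2 ⟨hb.1, hc.2⟩, hb.2⟩)
    have := card_le_six_of_triangle hw1 hcard h3 h4 h7 hX hY hZ hXY.symm hXZ.symm hYZ.symm hc.1 hc.2 ha.1 ha.2 hb.1 hb.2
      hab hac hbc
    omega
  · push Not at htri
    have htf : ∀ X ∈ ls, ∀ Y ∈ ls, ∀ Z ∈ ls, X ≠ Y → Y ≠ Z → X ≠ Z → (X ∩ Y).Nonempty → (Y ∩ Z).Nonempty →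
        (X ∩ Z).Nonempty → (X ∩ Y ∩ Z).Nonempty := by
      intro X hX Y hY Z hZ h1 h2 h3' n1 n2 n3
      exact htri X hX Y hY Z hZ h1 h2 h3' n1 n2 n3
    by_cases hmeet : ∃ A ∈ ls, ∃ X ∈ ls, A ≠ X ∧ (A ∩ X).Nonempty
    · obtain ⟨A, hA, X, hX, hAX, ⟨a, ha⟩⟩ := hmeet
      rw [Finset.mem_inter] at ha
      by_cases hY : ∃ B ∈ ls, a ∈ B ∧ ∃ Y ∈ ls, a ∉ Y ∧ (Y ∩ B).Nonempty
      · -- a line avoiding `a` meets a line `B` through `a`: the triangle-free count with a second pencil line `B'`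
        obtain ⟨B, hB, haB, Y, hYl, haY, hYB⟩ := hY
        have hYB' : Y ≠ B := fun h => haY (h ▸ haB)
        by_cases hBA : B = A
        · subst hBA
          exact tf_count hw1 hcard h3 h4 h7 htf hB hX hYl hAX hYB' (fun h => haY (h ▸ ha.2)) ha.1 ha.2 haY hYB
        · exact tf_count hw1 hcard h3 h4 h7 htf hB hA hYl hBA hYB' (fun h => haY (h ▸ ha.1)) haB ha.1 haY hYB
      · push Not at hY
        exact pencil_count hw1 hcard h3 h4 hA hX hAX ha.1 ha.2 (fun Y hYl haY B hB haB => by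
          rw [Finset.disjoint_iff_inter_eq_empty]
          exact hY B hB haB Y hYl haY)
    · push Not at hmeet
      rcases Finset.eq_empty_or_nonempty ls with h0 | ⟨A, hA⟩
      · rw [h0]; simp
      · exact card_le_seven_of_pairwise_disjoint hw1 hcard h3 h4 h7 hA (fun L hL hne => by
          rw [Finset.disjoint_iff_inter_eq_empty]
          exact hmeet L hL A hA hne)

end LinesP

end FourCap

end S1

end PercRepro
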